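import Summits.KontsevichZagierPeriods.KontsevichZagierPeriods.Theses.HurwitzMicroSectors
import Summits.KontsevichZagierPeriods.KontsevichZagierPeriods.Theorems.HurwitzMicroSectorsNormalFormPrinciplePiBoxTransfer

/-! TTRL-lite variant V2360 of stmt-KontsevichZagierPeriods-3869

Variant V2360 = the registered stub `stub_piCancellation` of line `SketchIdeator1` ITSELF (move
`target`), i.e. `Literature.NumberTheory.Transcendental.KZ.PiCancellation`:
`∀ c, [π]·c ∈ KZ.relations → c ∈ KZ.relations` (`[π] = [{x² + y² ≤ 1}, 1]`; item
stmt-KontsevichZagierPeriods-0540, an `@[conjecture]` of the tree). Verdict of the attempt seat: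
**open** — this file is the exact-strength certificate, not a proof of the variant:

* `stub_piCancellation_var2360_of_statement` : `KontsevichZagierPeriods → V2360` (kernel form of
  Conjecture 1 plus soundness, `leaves_of_statement`), so a refutation of V2360 refutes the Summit
  (`not_statement_of_not_stub_piCancellation_var2360`); with the sibling stub BoxRigidity it is
  EXACTLY the Summit (`statement_iff_leaves`, tree) and exactly the crux
  (`stub_piCancellation_var2360_of_normalFormPrinciple` with `normalFormPrinciple_of_leaves`);
* `stub_piCancellation_var2360_iff_piPow` : V2360 ⟺ `FormalRep ⧸ relations` has no
  `[π]^∞`-torsion (every power of `[π]` cancels);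
* `stub_piCancellation_var2360_of_retraction(_generator)` : the precise shape of the only known
  attack ("project a certificate for `[π]·c` to one for `c`"): ANY additive self-map of `FormalRep`
  that preserves `relations` and undoes `[π]·` modulo `relations` (on generators suffices) proves
  V2360. No such map is known: slicing the two disc coordinates at a point is not compatible with
  rule (2) (substitutions mix the disc coordinates with the others) nor with rule (1a) (a null
  overlap can have a non-null slice).

V2360 carries no arithmetic: by soundness `[π]·A ∼ [π]·B` already forces `vol A = vol B`, so the
statement is about certificates only (its motivic shadow, injectivity of formal effective periods
into formal periods with `2πi` inverted, is an open question in print: Huber–Wüstholz 2022, App. A.4).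
Equivalent forms already in the tree: `KZ.piCancellation_iff_injective`, and in
`Theorems/AyoubSpecialisationAyoubPiCancellationCylinderForms.lean` the generator / cylinder /
compact-cylinder / lift forms and `piCancellation_of_volumeConjectureCompact`; proved instances:
`piCancellation_of_dim_le_one` (dimension `≤ 1`, Baker), `piCancellationOn_of_kernelOn`.
Sources: M. Kontsevich, D. Zagier, *Periods* (2001), §1.2 Conjecture 1, §4.1 (`P̂ = P[1/2πi]`);
A. Huber, G. Wüstholz, *Transcendence and Linear Relations of 1-Periods* (2022), App. A.4.
Pure proof file, no definitions. -/

-- `Summit.<Summit>.<Problem>` is the tree's mandated summit-side namespace (CONVENTIONS §2); for this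
-- single-conjunct summit the two coincide, so the duplicate is deliberate.
set_option linter.dupNamespace false

noncomputable section

namespace Summit.KontsevichZagierPeriods.KontsevichZagierPeriods.Theorems

open MeasureTheory Set
open Literature.NumberTheory.Transcendental Literature.NumberTheory.Transcendental.KZ
open Summit.KontsevichZagierPeriods.KontsevichZagierPeriods.Theses.HurwitzMicroSectors
open Summit.KontsevichZagierPeriods.HurwitzMicroSectors.NormalFormPrinciple.PiBox

/-! ## Placement: between the Summit and nothing weaker that is known -/

/-- **`KontsevichZagierPeriods ⇒ V2360`**: `π`-cancellation follows from Conjecture 1 for the tree's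
calculus (kernel form plus soundness: `[π]·c ∈ relations ⇒ π · eval c = 0 ⇒ eval c = 0 ⇒ c ∈ relations`;
`leaves_of_statement`). So a refutation of the variant would refute the Summit.
[cite: KontsevichZagier2001, §1.2 Conjecture 1] -/
theorem stub_piCancellation_var2360_of_statement (h : _root_.KontsevichZagierPeriods) : PiCancellation :=
  (leaves_of_statement h).2

/-- **`¬ V2360 ⇒ ¬ KontsevichZagierPeriods`** (contrapositive placement, recorded for the variant
generator: the negative target `…Variants2360Neg` is a refutation of the Summit).
[cite: KontsevichZagier2001, §1.2 Conjecture 1] -/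
theorem not_statement_of_not_stub_piCancellation_var2360 (h : ¬ PiCancellation) :
    ¬ _root_.KontsevichZagierPeriods :=
  fun hS => h (stub_piCancellation_var2360_of_statement hS)

/-- **`NormalFormPrinciple ⇒ V2360`**: the crux of the route implies the variant (through the route's
deciding theorem `closes` and `leaves_of_statement`); conversely V2360 and BoxRigidity give the crux
(`normalFormPrinciple_of_leaves`, tree), so the variant is one of the two exact leaves of the crux.
[cite: KontsevichZagier2001, §1.2 Conjecture 1] -/
theorem stub_piCancellation_var2360_of_normalFormPrinciple (h : NormalFormPrinciple) : PiCancellation :=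
  (leaves_of_statement (closes h)).2

/-! ## V2360 ⟺ no `[π]^∞`-torsion -/

/-- **V2360 ⟺ every power of `[π]` cancels**: `PiCancellation` holds iff for all `k` and all formal
combinations `c`, `[π]^k·c ∈ relations → c ∈ relations` (left-nested powers as in `KZ.PiLocalKernel`;
`→` is `mem_of_piPow_mem`, `←` is `k = 1`). [cite: KontsevichZagier2001, §4.1] -/
theorem stub_piCancellation_var2360_iff_piPow :
    PiCancellation ↔
      ∀ (k : ℕ) (c : FormalRep), (fun x => of piRep * x)^[k] c ∈ relations → c ∈ relations :=
  ⟨fun h k _ hc => mem_of_piPow_mem h k hc, fun h c hc => h 1 c (by simpa using hc)⟩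

/-! ## What a proof must produce: a relations-preserving quasi-retraction of `[π]·` -/

/-- **A relations-preserving quasi-retraction of `[π]·` proves V2360.** If an additive self-map `ρ` of
`FormalRep` maps `relations` into `relations` and undoes left multiplication by `[π]` modulo
`relations` (`ρ ([π]·c) − c ∈ relations`), then `PiCancellation` holds:
`c = ρ([π]·c) − (ρ([π]·c) − c)`. This is the exact shape of the attack "project a certificate for
`[π]·c` to a certificate for `c`" recorded on item stmt-KontsevichZagierPeriods-0540; no such `ρ` is
known (slicing the disc coordinates is incompatible with rules (1a) and (2)).
[cite: KontsevichZagier2001, §4.1] -/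
theorem stub_piCancellation_var2360_of_retraction (ρ : FormalRep →+ FormalRep)
    (hρ : ∀ c ∈ relations, ρ c ∈ relations)
    (hπ : ∀ c : FormalRep, ρ (of piRep * c) - c ∈ relations) : PiCancellation := by
  intro c hc
  have e : c = ρ (of piRep * c) - (ρ (of piRep * c) - c) := by abel
  rw [e]
  exact relations.sub_mem (hρ _ hc) (hπ c)

/-- **The same with the retraction checked on generators only**: it suffices that
`ρ [disc × r] − [r] ∈ relations` for every single representation `r` (`[π]·[r] = [piRep.prod r]`,
`KZ.of_mul_of`), by additivity of `ρ` and of `[π]·`. [cite: KontsevichZagier2001, §4.1] -/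
theorem stub_piCancellation_var2360_of_retraction_generator (ρ : FormalRep →+ FormalRep)
    (hρ : ∀ c ∈ relations, ρ c ∈ relations)
    (hπ : ∀ (n : ℕ) (r : IntegralRep n), ρ (of (piRep.prod r)) - of r ∈ relations) :
    PiCancellation := by
  refine stub_piCancellation_var2360_of_retraction ρ hρ fun c => ?_
  induction c using FreeAbelianGroup.induction_on with
  | zero => simp [relations.zero_mem]
  | of s =>
    obtain ⟨n, r⟩ := s
    have e : (FreeAbelianGroup.of ⟨n, r⟩ : FormalRep) = of r := rfl
    rw [e, of_mul_of]
    exact hπ n r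
  | neg s ih =>
    have e : ρ (of piRep * -FreeAbelianGroup.of s) - -FreeAbelianGroup.of s =
        -(ρ (of piRep * FreeAbelianGroup.of s) - FreeAbelianGroup.of s) := by
      rw [mul_neg, map_neg]; abel
    rw [e]
    exact relations.neg_mem ih
  | add x y hx hy =>
    have e : ρ (of piRep * (x + y)) - (x + y) =
        (ρ (of piRep * x) - x) + (ρ (of piRep * y) - y) := by
      rw [mul_add, map_add]; abel
    rw [e]
    exact relations.add_mem hx hy

end Summit.KontsevichZagierPeriods.KontsevichZagierPeriods.Theorems

end
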